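import Summits.HodgeConjecture.CorCM.OcticWeilMixedSixfoldParts
import Summits.HodgeConjecture.CorCM.OcticWeilOrbitRealisers
import Summits.HodgeConjecture.CorCM.OcticCurveFourfoldWeilSixfold
import HarnessLib

/-!
# COR-CM — the Hodge conjecture for EVERY PRODUCT OF COPIES of `E, B₁, B₂, B'` — the CM curve of `k`, two `(2,2)`-types in
# general position and ONE `(1,3)`-type of ONE octic CM field `F ⊇ k` — GIVEN ONLY Markman's fourfold AND hyperbolic-sixfold
# theorems: the FRAME FORM

Cell `pub-hodgecm2` (COR-CM), seat b30 gen 20 (2026-08-22); count-neutral own lane OCTIC-WEIL-ORBIT, part MIXED — assembly.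
Theorems only; no definition, no `sorry`; the TWO named facts are DISPLAYED as hypotheses:
`Markman2025_weilClasses_algebraic_abelianFourfold` (the Weil parts of `B₁, B₂`) and
`Markman2025_weilClasses_algebraic_hyperbolicSixfold` (the Weil plane of `(B' × E) × E`, via gen 18's
`OcticCurveFourfold.weilClassesOf_le_algebraicClasses_cmFourfold_prod_cmCurve_prod_cmCurve_of_markmanSixfold`).

THE ARGUMENT.  For `X = ⨁_j A₄(κ j)` — ANY product of copies of `E = A₄ 0 ⊨ (k; {τ})`, `B₁ = A₄ 1 ⊨ (F; Φ_{I_0})`,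
`B₂ = A₄ 2 ⊨ (F; Φ_{I_1})`, `B' = A₄ 3 ⊨ (F; Φ'_c)` — a rational `(p,p)`-class lies in the span of the weight lines over
Pohlmann's balanced weights (`Pohlmann1968_thm1_cmAlgebra`); by FRAME TRANSFER (`modelBalancedM_of_isGaloisBalancedAlg`) such a
weight is a balanced configuration of the mixed model, hence (kernel census `Census/OcticWeilMixed(Parts)`: the DEFECT LAW
and `modelBalancedM_induction`) a disjoint union of PAIR PARTS (divisor lines, ORBIT lemma), WEIL PARTS of `B₁, B₂`
(Markman's fourfold theorem, `weightClassesAlg_le_algebraicClasses_of_isWeil₃Part_slot`) and SIXFOLD PARTS (Markman's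
sixfold theorem, `weightClassesAlg_le_algebraicClasses_of_isSix₃Part`); lines of disjoint unions multiply.
HONEST FRAMING: conditional on the two displayed Markman binders (unrefereed); nothing here asserts `HC_CM`.

## References
* [Pohlmann1968] H. Pohlmann, Ann. of Math. 88 (1968), Thm 1.  [GaoUllmo2025] Z. Gao, E. Ullmo, J. Inst. Math. Jussieu 25
  (2025), Thm 3.1.  [Milne2020HodgeClassesAV] J. S. Milne, arXiv:2010.08857, 1.2 (a), Thm. 1.  [Markman2025SurveySecant]
  E. Markman, arXiv:2509.23403, Thm. 1.2.  [Markman2025SecantWeil] E. Markman, arXiv:2502.03415, Thm 1.5.1.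
  [Deligne1982HodgeCycles] LNM 900 (1982), §4 Prop. 4.4, §5 (c).  [Dodson1984] B. Dodson, Trans. AMS 283 (1984), §3.3.2.
-/

noncomputable section

open CategoryTheory CategoryTheory.Limits NumberField

namespace Summit.HodgeConjecture.CorCM.OcticWeilMixed

open Literature.AlgebraicGeometry Literature.AlgebraicGeometry.Motives Literature.AlgebraicGeometry.HodgeTheory
open Literature.AlgebraicGeometry.ComplexMultiplication (IsCMTypeRealisation)
open Literature.AlgebraicGeometry.Pohlmann1968
open Literature.AlgebraicTopology.SingularHomology
open Literature.NumberTheory.ComplexMultiplication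
open Summit.HodgeConjecture.CorCM.Census.OcticWeilOrbit (Pt₃ permTab signTab IsPairPart₃ IsWeil₃Part)
open Summit.HodgeConjecture.CorCM.Census.OcticWeilMixed (signTabM signTabM_two ModelBalancedM IsSix₃Part
  modelBalancedM_induction)
open Summit.HodgeConjecture.CorCM.OcticWeilOrbit (orbitSlots toPt₃ weightClassesAlg_le_algebraicClasses_of_isPairPart₃
  hgal_of_h2t)
open Summit.HodgeConjecture.CorCM.OcticCurveFourfold (comp_eq_conjugate_of_snd_eq_false
  weilClassesOf_le_algebraicClasses_cmFourfold_prod_cmCurve_prod_cmCurve_of_markmanSixfold)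
open Summit.HodgeConjecture.CorCM.PairWeights
open Summit.HodgeConjecture.CorCM.DihedralSexticPair (card_filter_equiv_mem)

open scoped Classical Pointwise

section Assembly

variable {I : Type} {Kf : I → Type} [∀ i, Field (Kf i)] [∀ i, NumberField (Kf i)] [∀ i, IsCMField (Kf i)]
  {i₀ i₁ : I} {N : ℕ} {τ : Kf i₀ →+* ℂ} {e : (Kf i₁ →+* ℂ) ≃ Fin 4 × Bool} {i : Kf i₀ →+* Kf i₁}
  {A₄ : Fin 4 → AbelianVariety ℂ} {Φ₄ : ∀ j : Fin 4, CMType (Kf (orbitSlots i₀ i₁ j))}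
  {ι₄ : ∀ j, 𝓞 (Kf (orbitSlots i₀ i₁ j)) →+* End (A₄ j)}
  {θ₄ : ∀ j, Kf (orbitSlots i₀ i₁ j) →+* Module.End ℂ (complexBetti (A₄ j).X 1)}

/-! ### The count `(1 + 2·1, 3 + 2·0) = (3, 3)` of the `(1,3)`-slot, read off the frame -/

omit [∀ i, NumberField (Kf i)] [∀ i, IsCMField (Kf i)] in
/-- The finite facts of the `(1,3)`-slot: one label `(a, true)` and three labels `(a, false)` satisfy `s = [a = c]`. [folklore] -/
theorem card_sixTab_sign (c : Fin 4) :
    ((Finset.univ : Finset (Fin 4 × Bool)).filter fun p => p.2 = true ∧ p.2 = signTabM c 0 2 p.1).card = 1 ∧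
    ((Finset.univ : Finset (Fin 4 × Bool)).filter fun p => p.2 = false ∧ p.2 = signTabM c 0 2 p.1).card = 3 := by
  revert c
  unfold signTabM Census.OcticWeilMixed.sixTab
  decide

omit [∀ i, IsCMField (Kf i)] in
/-- **The type count of the `(1,3)`-slot read off the frame**: for `s ∈ Φ' ⟺ (e s).2 = [(e s).1 = c]` and `Ψ = {τ}`, every
embedding `τ'` of `k` has `#{s ∈ Φ' | s ∘ i = τ'} + 2·[τ' ∈ Ψ] = 3` — the Weil-type condition of the sixfold `(B' × E) × E`.
[cite: Deligne1982HodgeCycles, §5 (c)] -/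
theorem typeCount_sixfold_of_frameM (hττ : ComplexEmbedding.conjugate τ ≠ τ)
    (hk : ∀ σ : Kf i₀ →+* ℂ, σ = τ ∨ σ = ComplexEmbedding.conjugate τ)
    (he_sign : ∀ s : Kf i₁ →+* ℂ, (e s).2 = true ↔ s.comp i = τ) {c : Fin 4}
    {Φ : CMType (Kf i₁)} (hΦ : ∀ s : Kf i₁ →+* ℂ, s ∈ Φ.1 ↔ (e s).2 = signTabM c 0 2 (e s).1)
    {Ψ : CMType (Kf i₀)} (hΨ : ∀ σ : Kf i₀ →+* ℂ, σ ∈ Ψ.1 ↔ σ = τ) (τ' : Kf i₀ →+* ℂ) :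
    (Finset.univ.filter fun s : Kf i₁ →+* ℂ => s.comp i = τ' ∧ s ∈ Φ.1).card + 2 * (if τ' ∈ Ψ.1 then 1 else 0) = 3 := by
  rcases hk τ' with rfl | rfl
  · rw [if_pos ((hΨ τ').2 rfl)]
    have hfilter : (Finset.univ.filter fun s : Kf i₁ →+* ℂ => s.comp i = τ' ∧ s ∈ Φ.1) =
        Finset.univ.filter fun s => e s ∈
          ((Finset.univ : Finset (Fin 4 × Bool)).filter fun p => p.2 = true ∧ p.2 = signTabM c 0 2 p.1) := by
      refine Finset.filter_congr fun s _ => ?_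
      rw [← he_sign, hΦ s, Finset.mem_filter]
      exact ⟨fun h => ⟨Finset.mem_univ _, h⟩, fun h => h.2⟩
    rw [hfilter, card_filter_equiv_mem, (card_sixTab_sign c).1]
  · have hnot : ComplexEmbedding.conjugate τ ∉ Ψ.1 := fun h => hττ ((hΨ _).1 h)
    rw [if_neg hnot, mul_zero, add_zero]
    have hfilter : (Finset.univ.filter fun s : Kf i₁ →+* ℂ => s.comp i = ComplexEmbedding.conjugate τ ∧ s ∈ Φ.1) =
        Finset.univ.filter fun s => e s ∈
          ((Finset.univ : Finset (Fin 4 × Bool)).filter fun p => p.2 = false ∧ p.2 = signTabM c 0 2 p.1) := by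
      refine Finset.filter_congr fun s _ => ?_
      rw [hΦ s, Finset.mem_filter]
      constructor
      · rintro ⟨h1, h3⟩
        refine ⟨Finset.mem_univ _, ?_, h3⟩
        cases hs : (e s).2
        · rfl
        · exact absurd (((he_sign s).1 hs).symm.trans h1) hττ.symm
      · rintro ⟨-, h1, h3⟩
        exact ⟨comp_eq_conjugate_of_snd_eq_false hk he_sign h1, h3⟩
    rw [hfilter, card_filter_equiv_mem, (card_sixTab_sign c).2]

/-! ### Assembly -/

/-- **MAIN THEOREM (frame form).  The Hodge conjecture for every product of copies `⨁_j A₄(κ j)` of `E, B₁, B₂, B'` — i.e. for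
`E^a × B₁^{n₁} × B₂^{n₂} × B'^{n'}`, all exponents, any order — GIVEN ONLY Markman's fourfold and hyperbolic-sixfold theorems**,
for `E ⊨ (k; {τ})` (`δ ∈ 𝓞_k`, `δ² = −d`, `τ(δ) = i√d`), `B₁, B₂ ⊨ (F; Φ_{I_0}), (F; Φ_{I_1})` two `(2,2)`-types in general
position and `B' ⊨ (F; Φ'_c)` a `(1,3)`-type of an octic CM field `F ⊇ i(k)`, read in a frame `e` through the mixed table
(`hΦ`), whose conjugate pairs admit every EVEN permutation under `Aut(ℂ)` (`hgal`; Dodson: automatic when `B₁` is simple).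
Leaves: the two Markman facts ONLY. [cite: Markman2025SurveySecant, Thm. 1.2] [cite: Markman2025SecantWeil, Thm 1.5.1]
[cite: Pohlmann1968, Thm 1] [cite: Milne2020HodgeClassesAV, 1.2 (a) and Thm. 1] [cite: Dodson1984, §3.3.2 Theorem] -/
theorem hodgeConjectureFor_biproduct_comp_of_frameM_of_markman
    (hW4 : Markman2025_weilClasses_algebraic_abelianFourfold) (hM6 : Markman2025_weilClasses_algebraic_hyperbolicSixfold)
    (κ : Fin N → Fin 4) (h8 : Module.finrank ℚ (Kf i₁) = 8) (h2 : Module.finrank ℚ (Kf i₀) = 2) (i : Kf i₀ →+* Kf i₁)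
    {δ : 𝓞 (Kf i₀)} {d : ℕ} (hd : 0 < d) (hδ : ((δ : Kf i₀)) ^ 2 = -(d : Kf i₀))
    (hτ : τ (δ : Kf i₀) = Complex.I * (Real.sqrt d : ℂ))
    (hA : ∀ j, IsCMTypeRealisation (Φ₄ j) (A₄ j) (ι₄ j) (θ₄ j))
    (e : (Kf i₁ →+* ℂ) ≃ Fin 4 × Bool)
    (he_sign : ∀ s : Kf i₁ →+* ℂ, (e s).2 = true ↔ s.comp i = τ)
    (he_conj : ∀ s : Kf i₁ →+* ℂ, e (ComplexEmbedding.conjugate s) = ((e s).1, !(e s).2)) {c : Fin 4}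
    (hΦ : ∀ (m : Fin 3) (s : Kf i₁ →+* ℂ), s ∈ (Φ₄ m.succ).1 ↔ (e s).2 = signTabM c 0 m (e s).1)
    (hΨ : ∀ σ : Kf i₀ →+* ℂ, σ ∈ (Φ₄ 0).1 ↔ σ = τ)
    (hgal : ∀ r : Fin 12, ∃ ρ : ℂ ≃+* ℂ,
      ∀ a : Fin 4, (ρ : ℂ →+* ℂ).comp (e.symm (a, true)) = e.symm (permTab r a, true)) :
    HodgeConjectureFor (⨁ fun j => A₄ (κ j)).dim (⨁ fun j => A₄ (κ j)).X := by
  have hττ : ComplexEmbedding.conjugate τ ≠ τ := QuarticCM.conjugate_ne τ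
  have hk : ∀ σ : Kf i₀ →+* ℂ, σ = τ ∨ σ = ComplexEmbedding.conjugate τ := fun σ =>
    QuarticCM.eq_or_eq_conjugate_of_quadratic h2 τ σ
  have hcount : ∀ (m : Fin 3), m ≠ 2 → ∀ (τ' : Kf i₀ →+* ℂ),
      (Finset.univ.filter fun s : Kf i₁ →+* ℂ => s.comp i = τ' ∧ s ∈ (Φ₄ m.succ).1).card = 2 :=
    fun m hm => typeCount_eq_two_of_frameM h2 he_sign hm (hΦ m)
  -- the Weil plane of `(B' × E) × E`, algebraic by Markman's sixfold theorem
  have hW₃ := weilClassesOf_le_algebraicClasses_cmFourfold_prod_cmCurve_prod_cmCurve_of_markmanSixfold hM6 h8 h2 i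
    (hA 3) (hA 0) hd hδ fun τ' => typeCount_sixfold_of_frameM hττ hk he_sign (Φ := Φ₄ 3) (hΦ 2) hΨ τ'
  refine ⟨nonempty_hodgeModel_holds (Motives.AbelianVariety.isSmoothProjective_holds (A := ⨁ fun j => A₄ (κ j))),
    fun p cl hc hH => ?_⟩
  have hAκ : ∀ j, IsCMTypeRealisation (Φ₄ (κ j)) (A₄ (κ j)) (ι₄ (κ j)) (θ₄ (κ j)) := fun j => hA (κ j)
  -- every balanced configuration has algebraic weight lines: induct over its generating parts
  have key : ∀ (R : Finset ((j : Fin N) × (Kf (orbitSlots i₀ i₁ (κ j)) →+* ℂ))),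
      ModelBalancedM c (fun x => toPt₃ e τ ((Sigma.map κ (fun _ => id) :
        ((j : Fin N) × (Kf (orbitSlots i₀ i₁ (κ j)) →+* ℂ)) → ((m : Fin 4) × (Kf (orbitSlots i₀ i₁ m) →+* ℂ))) x)) R →
      ∀ q, R.card = 2 * q → weightClassesAlg (fun j => A₄ (κ j)) (fun j => ι₄ (κ j)) (2 * q) R ≤
        algebraicClasses (⨁ fun j => A₄ (κ j)).X q := by
    intro R hR
    refine modelBalancedM_induction (c := c) (motive := fun R => ∀ q, R.card = 2 * q →
      weightClassesAlg (fun j => A₄ (κ j)) (fun j => ι₄ (κ j)) (2 * q) R ≤ algebraicClasses (⨁ fun j => A₄ (κ j)).X q)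
      (fun q hq => ?_) (fun G R hGR hG ih q hq => ?_) (fun G R m b hm hGR hG ih q hq => ?_)
      (fun G R b hGR hG ih q hq => ?_) hR
    · obtain rfl : q = 0 := by simpa using hq.symm
      exact fun c' _ => hodgeConjectureFor_codim_zero c'
    · -- a pair part: a divisor line (ORBIT lemma, same model map)
      obtain ⟨ha, hGalg⟩ := weightClassesAlg_le_algebraicClasses_of_isPairPart₃ κ hττ hk he_conj hA hG
      have hRcard : R.card = 2 * (q - 1) := by
        have h := Finset.card_union_of_disjoint hGR; rw [hq, ha] at h; omega
      have haq : 1 + (q - 1) = q := by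
        have h := Finset.card_union_of_disjoint hGR; rw [hq, ha] at h; omega
      rw [← Finset.disjUnion_eq_union G R hGR]
      exact weightClassesAlg_union_le_algebraicClasses hAκ haq ha hRcard hGR hGalg (ih (q - 1) hRcard)
    · -- a Weil part of `B₁` or `B₂`: Markman's fourfold theorem
      obtain ⟨ha, hGalg⟩ :=
        weightClassesAlg_le_algebraicClasses_of_isWeil₃Part_slot κ hW4 h8 h2 hττ hk he_sign hA (hcount m hm) hG
      have hRcard : R.card = 2 * (q - 2) := by
        have h := Finset.card_union_of_disjoint hGR; rw [hq, ha] at h; omega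
      have haq : 2 + (q - 2) = q := by
        have h := Finset.card_union_of_disjoint hGR; rw [hq, ha] at h; omega
      rw [← Finset.disjUnion_eq_union G R hGR]
      exact weightClassesAlg_union_le_algebraicClasses hAκ haq ha hRcard hGR hGalg (ih (q - 2) hRcard)
    · -- a sixfold part: the Weil plane of `(B' × E) × E`, Markman's sixfold theorem
      obtain ⟨ha, hGalg⟩ := weightClassesAlg_le_algebraicClasses_of_isSix₃Part hk he_sign hA hτ hW₃ κ hG
      have hRcard : R.card = 2 * (q - 3) := by
        have h := Finset.card_union_of_disjoint hGR; rw [hq, ha] at h; omega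
      have haq : 3 + (q - 3) = q := by
        have h := Finset.card_union_of_disjoint hGR; rw [hq, ha] at h; omega
      rw [← Finset.disjUnion_eq_union G R hGR]
      exact weightClassesAlg_union_le_algebraicClasses hAκ haq ha hRcard hGR hGalg (ih (q - 3) hRcard)
  have hmem : cl ∈ ⨆ S ∈ pohlmannSetsAlg (K := fun j => Kf (orbitSlots i₀ i₁ (κ j))) (fun j => Φ₄ (κ j)) p,
      weightClassesAlg (fun j => A₄ (κ j)) (fun j => ι₄ (κ j)) (2 * p) S := by
    rw [← (Pohlmann1968_thm1_cmAlgebra (fun j => Kf (orbitSlots i₀ i₁ (κ j))) (fun j => A₄ (κ j))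
      (fun j => Φ₄ (κ j)) (fun j => ι₄ (κ j)) (fun j => θ₄ (κ j)) hAκ p).1]
    exact Submodule.subset_span ⟨hc, hH⟩
  have hle : (⨆ S ∈ pohlmannSetsAlg (K := fun j => Kf (orbitSlots i₀ i₁ (κ j))) (fun j => Φ₄ (κ j)) p,
      weightClassesAlg (fun j => A₄ (κ j)) (fun j => ι₄ (κ j)) (2 * p) S) ≤
      algebraicClasses (⨁ fun j => A₄ (κ j)).X p := by
    refine iSup₂_le fun S hS => ?_
    exact key S (modelBalancedM_of_isGaloisBalancedAlg hττ hk he_sign he_conj hΦ hΨ κ hgal hS.2) p hS.1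
  exact hle hmem

/-- **The frame form under `2`-TRANSITIVITY** (`h2t`, as in OCTIC-WEIL22 / ORBIT; Dodson: automatic when `B₁` is simple): the
twelve even permutations are realised by `OcticWeilOrbit.hgal_of_h2t`. [cite: Markman2025SurveySecant, Thm. 1.2]
[cite: Markman2025SecantWeil, Thm 1.5.1] [cite: Dodson1984, §3.3.2 Theorem] -/
theorem hodgeConjectureFor_biproduct_comp_of_frameM_of_markman_h2t
    (hW4 : Markman2025_weilClasses_algebraic_abelianFourfold) (hM6 : Markman2025_weilClasses_algebraic_hyperbolicSixfold)
    (κ : Fin N → Fin 4) (h8 : Module.finrank ℚ (Kf i₁) = 8) (h2 : Module.finrank ℚ (Kf i₀) = 2) (i : Kf i₀ →+* Kf i₁)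
    {δ : 𝓞 (Kf i₀)} {d : ℕ} (hd : 0 < d) (hδ : ((δ : Kf i₀)) ^ 2 = -(d : Kf i₀))
    (hτ : τ (δ : Kf i₀) = Complex.I * (Real.sqrt d : ℂ))
    (hA : ∀ j, IsCMTypeRealisation (Φ₄ j) (A₄ j) (ι₄ j) (θ₄ j))
    (e : (Kf i₁ →+* ℂ) ≃ Fin 4 × Bool)
    (he_sign : ∀ s : Kf i₁ →+* ℂ, (e s).2 = true ↔ s.comp i = τ)
    (he_conj : ∀ s : Kf i₁ →+* ℂ, e (ComplexEmbedding.conjugate s) = ((e s).1, !(e s).2)) {c : Fin 4}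
    (hΦ : ∀ (m : Fin 3) (s : Kf i₁ →+* ℂ), s ∈ (Φ₄ m.succ).1 ↔ (e s).2 = signTabM c 0 m (e s).1)
    (hΨ : ∀ σ : Kf i₀ →+* ℂ, σ ∈ (Φ₄ 0).1 ↔ σ = τ)
    (h2t : ∀ a b : Fin 4, a ≠ b → ∃ ρ : ℂ ≃+* ℂ,
      (ρ : ℂ →+* ℂ).comp (e.symm (a, true)) = e.symm (0, true) ∧ (ρ : ℂ →+* ℂ).comp (e.symm (b, true)) = e.symm (1, true)) :
    HodgeConjectureFor (⨁ fun j => A₄ (κ j)).dim (⨁ fun j => A₄ (κ j)).X :=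
  hodgeConjectureFor_biproduct_comp_of_frameM_of_markman hW4 hM6 κ h8 h2 i hd hδ hτ hA e he_sign he_conj hΦ hΨ
    (hgal_of_h2t he_sign h2t)

end Assembly

end Summit.HodgeConjecture.CorCM.OcticWeilMixed

end
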